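import Literature.Computability.QuantumComplexity.ZXCalculusSymmetricDiagram
import HarnessLib

/-!
# ZX-calculus: the leafy four-cycle (two leaf nodes in parallel between a copy and a merge)

`√2 ⊗ (Z^{(1,2)} ⨾ (xLeafL 0 α ⊗ xLeafL 0 β) ⨾ Z^{(2,1)}) = xLeafL 0 (α + β)`: the bialgebra rule (B2) bent so that one
green node becomes the final merge. Used for the transistor lemmas of Jeandel–Perdrix–Vilmart LICS 2019
(`2-triangle-cycle` and relatives). [cite: JeandelPerdrixVilmart2018, Fig. 1 (B2)]
-/

namespace Literature.Computability.QuantumComplexity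

open ZXDiagram

namespace ZXClass

/-- A leaf node with its output capped against a parallel wire is the red merge with the leaf's effect:
`(xLeafL 0 α ⊗ 𝕀) ⨾ ∪ᵗ = X^{(2,1)} ⨾ Z^{(1,0)}(α)`. [cite: JeandelPerdrixVilmart2018, §2.2] -/
theorem xLeafL_par_wire_seq_cap (a : ZMod 8) : (mk (xLeafL 0 a) ⊠ mk (wires 1)) ⨟ mk cap = mk (X 2 1 0) ⨟ mk (Z 1 0 a) := by
  have e : (mk (Z 1 0 a) ⊠ mk (wires 2)) ⨟ mk cap = (mk (wires 1) ⊠ mk cap) ⨟ mk (Z 1 0 a) := by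
    have h1 := par_eq_seq_left (mk (Z 1 0 a)) (mk cap)
    have h2 := par_eq_seq_right (mk (Z 1 0 a)) (mk cap)
    rw [empty_par, cast_id] at h1
    rw [par_empty] at h2
    exact h1.symm.trans h2
  simp only [xLeafL, mk_seq, mk_par]
  rw [seq_par_wires, seq_assoc, show (mk (Z 1 0 a) ⊠ mk (wires 1)) ⊠ mk (wires 1) = mk (Z 1 0 a) ⊠ mk (wires 2) from by
      rw [← wires_par_wires 1 1]; exact (par_assoc _ _ _).trans (cast_id _ _ _),
    e, ← seq_assoc, xsplit_par_seq_par_cap]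

/-- **Yanking two legs of `Z^{(0,3)}` against two wires gives the merge**:
`(𝕀² ⊗ Z^{(0,3)}) ⨾ (𝕀 ⊗ σ ⊗ 𝕀²) ⨾ (∪ᵗ ⊗ ∪ᵗ ⊗ 𝕀) = Z^{(2,1)}`. [cite: JeandelPerdrixVilmart2018, §2.2] -/
theorem wires_par_Z_zero_three_yank :
    (mk (wires 2) ⊠ mk (Z 0 3 0)) ⨟ (((mk (wires 1) ⊠ mk swap) ⊠ mk (wires 1)) ⊠ mk (wires 1)) ⨟ ((mk cap ⊠ mk cap) ⊠ mk (wires 1)) = mk (Z 2 1 0) := by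
  -- the merge bent on its first input
  have hbend : (mk (wires 1) ⊠ mk (Z 1 2 0)) ⨟ (mk cap ⊠ mk (wires 1)) = mk (Z 2 1 0) := by
    have h := congrArg colorSwap par_xsplit_seq_cap_par
    simpa using h
  -- `Z^{(0,3)} = ∪ ⨾ (𝕀 ⊗ Z^{(1,2)})`; the copy on the cup's second leg commutes past the crossing of wires 2,3
  have h1 : (mk (wires 2) ⊠ mk (Z 0 3 0)) ⨟ (((mk (wires 1) ⊠ mk swap) ⊠ mk (wires 1)) ⊠ mk (wires 1)) =
      (mk (wires 1) ⊠ ((mk (wires 1) ⊠ mk cup) ⨟ (mk swap ⊠ mk (wires 1)))) ⨟ (mk (wires 3) ⊠ mk (Z 1 2 0)) := by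
    rw [Z_zero_three_eq_cup_par_split, wires_par_seq, seq_assoc,
      show (mk (wires 2) ⊠ (mk (wires 1) ⊠ mk (Z 1 2 0))) ⨟ (((mk (wires 1) ⊠ mk swap) ⊠ mk (wires 1)) ⊠ mk (wires 1)) =
        ((mk (wires 1) ⊠ mk swap) ⊠ mk (wires 1)) ⨟ (mk (wires 3) ⊠ mk (Z 1 2 0)) from by
          rw [show mk (wires 2) ⊠ (mk (wires 1) ⊠ mk (Z 1 2 0)) = mk (wires 3) ⊠ mk (Z 1 2 0) from by
              rw [← wires_par_wires 2 1]; exact (par_assoc' _ _ _).trans (cast_id _ _ _),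
            show ((mk (wires 1) ⊠ mk swap) ⊠ mk (wires 1)) ⊠ mk (wires 1) = (mk (wires 1) ⊠ mk swap) ⊠ mk (wires 2) from by
              rw [← wires_par_wires 1 1]; exact (par_assoc _ _ _).trans (cast_id _ _ _),
            interchange, id_seq, seq_id, par_eq_seq_left (mk (wires 1) ⊠ mk swap) (mk (Z 1 2 0))],
      ← seq_assoc, ← wires_par_wires 1 1,
      show (mk (wires 1) ⊠ mk (wires 1)) ⊠ mk cup = mk (wires 1) ⊠ (mk (wires 1) ⊠ mk cup) from (par_assoc _ _ _).trans (cast_id _ _ _),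
      show (mk (wires 1) ⊠ mk swap) ⊠ mk (wires 1) = mk (wires 1) ⊠ (mk swap ⊠ mk (wires 1)) from (par_assoc _ _ _).trans (cast_id _ _ _),
      ← wires_par_seq]
  have hC : (mk cap ⊠ mk cap) ⊠ mk (wires 1) = (mk cap ⊠ mk (wires 3)) ⨟ (mk cap ⊠ mk (wires 1)) := by
    rw [par_eq_seq_left (mk cap) (mk cap), empty_par, cast_id, seq_par_wires,
      show (mk cap ⊠ mk (wires 2)) ⊠ mk (wires 1) = mk cap ⊠ mk (wires 3) from by rw [← wires_par_wires 2 1]; exact (par_assoc _ _ _).trans (cast_id _ _ _)]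
  have hZ : (mk (wires 3) ⊠ mk (Z 1 2 0)) ⨟ (mk cap ⊠ mk (wires 3)) = (mk cap ⊠ mk (wires 2)) ⨟ (mk (wires 1) ⊠ mk (Z 1 2 0)) := by
    rw [show mk (wires 3) ⊠ mk (Z 1 2 0) = mk (wires 2) ⊠ (mk (wires 1) ⊠ mk (Z 1 2 0)) from by rw [← wires_par_wires 2 1]; exact (par_assoc _ _ _).trans (cast_id _ _ _),
      show mk cap ⊠ mk (wires 3) = mk cap ⊠ (mk (wires 1) ⊠ mk (wires 2)) from by rw [wires_par_wires],
      interchange, id_seq, wires_par_wires, seq_id, par_eq_seq_left (mk cap) (mk (wires 1) ⊠ mk (Z 1 2 0)), empty_par, cast_id]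
  have hS : (mk (wires 1) ⊠ (mk (wires 1) ⊠ mk swap)) ⨟ (mk cap ⊠ mk (wires 2)) = (mk cap ⊠ mk (wires 2)) ⨟ mk swap := by
    rw [show mk (wires 1) ⊠ (mk (wires 1) ⊠ mk swap) = mk (wires 2) ⊠ mk swap from by rw [← wires_par_wires 1 1]; exact (par_assoc' _ _ _).trans (cast_id _ _ _),
      interchange, id_seq, seq_id, par_eq_seq_left (mk cap) (mk swap), empty_par, cast_id]
  have hsnake : (mk (wires 1) ⊠ (mk cup ⊠ mk (wires 1))) ⨟ (mk cap ⊠ mk (wires 2)) = mk (wires 2) := by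
    rw [show mk (wires 1) ⊠ (mk cup ⊠ mk (wires 1)) = (mk (wires 1) ⊠ mk cup) ⊠ mk (wires 1) from (par_assoc' _ _ _).trans (cast_id _ _ _),
      show mk cap ⊠ mk (wires 2) = (mk cap ⊠ mk (wires 1)) ⊠ mk (wires 1) from by rw [← wires_par_wires 1 1]; exact (par_assoc' _ _ _).trans (cast_id _ _ _),
      ← seq_par_wires, snake_left, wires_par_wires]
  rw [h1, par_cup_swap_par, wires_par_seq, hC, seq_assoc, seq_assoc, ← seq_assoc (mk (wires 3) ⊠ mk (Z 1 2 0)) (mk cap ⊠ mk (wires 3)), hZ,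
    ← seq_assoc (mk (wires 1) ⊠ (mk (wires 1) ⊠ mk swap)), ← seq_assoc (mk (wires 1) ⊠ (mk (wires 1) ⊠ mk swap)), hS,
    ← seq_assoc (mk (wires 1) ⊠ (mk cup ⊠ mk (wires 1))), ← seq_assoc (mk (wires 1) ⊠ (mk cup ⊠ mk (wires 1))),
    ← seq_assoc (mk (wires 1) ⊠ (mk cup ⊠ mk (wires 1))), hsnake, id_seq, seq_assoc, hbend, swap_seq_Z]

/-- **The leafy four-cycle**: two leaf nodes in parallel between a copy and a merge are one leaf node,
`√2 ⊗ (Z^{(1,2)} ⨾ (xLeafL 0 α ⊗ xLeafL 0 β) ⨾ Z^{(2,1)}) = xLeafL 0 (α + β)` ((B2) with one green node bent into the merge).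
[cite: JeandelPerdrixVilmart2018, Fig. 1 (B2)] -/
theorem leafy_four_cycle (p q : ZMod 8) :
    mk (dumbbell 0 0) ⊠ (mk (Z 1 2 0) ⨟ (mk (xLeafL 0 p) ⊠ mk (xLeafL 0 q)) ⨟ mk (Z 2 1 0)) = mk (xLeafL 0 (p + q)) := by
  -- regroupings of the two leaf nodes among wires
  have g1 : (mk (xLeafL 0 p) ⊠ mk (wires 1)) ⊠ (mk (xLeafL 0 q) ⊠ mk (wires 1)) = (mk (xLeafL 0 p) ⊠ (mk (wires 1) ⊠ mk (xLeafL 0 q))) ⊠ mk (wires 1) := by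
    have e1 : (mk (xLeafL 0 p) ⊠ mk (wires 1)) ⊠ (mk (xLeafL 0 q) ⊠ mk (wires 1)) = mk (xLeafL 0 p) ⊠ (mk (wires 1) ⊠ (mk (xLeafL 0 q) ⊠ mk (wires 1))) := (par_assoc _ _ _).trans (cast_id _ _ _)
    have e2 : mk (wires 1) ⊠ (mk (xLeafL 0 q) ⊠ mk (wires 1)) = (mk (wires 1) ⊠ mk (xLeafL 0 q)) ⊠ mk (wires 1) := (par_assoc' _ _ _).trans (cast_id _ _ _)
    have e3 : mk (xLeafL 0 p) ⊠ ((mk (wires 1) ⊠ mk (xLeafL 0 q)) ⊠ mk (wires 1)) = (mk (xLeafL 0 p) ⊠ (mk (wires 1) ⊠ mk (xLeafL 0 q))) ⊠ mk (wires 1) := (par_assoc' _ _ _).trans (cast_id _ _ _)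
    rw [e1, e2, e3]
  have g2 : (mk (xLeafL 0 p) ⊠ (mk (xLeafL 0 q) ⊠ mk (wires 1))) ⊠ mk (wires 1) = (mk (xLeafL 0 p) ⊠ mk (xLeafL 0 q)) ⊠ mk (wires 2) := by
    have e1 : (mk (xLeafL 0 p) ⊠ (mk (xLeafL 0 q) ⊠ mk (wires 1))) ⊠ mk (wires 1) = mk (xLeafL 0 p) ⊠ ((mk (xLeafL 0 q) ⊠ mk (wires 1)) ⊠ mk (wires 1)) := (par_assoc _ _ _).trans (cast_id _ _ _)
    have e2 : (mk (xLeafL 0 q) ⊠ mk (wires 1)) ⊠ mk (wires 1) = mk (xLeafL 0 q) ⊠ mk (wires 2) := by rw [← wires_par_wires 1 1]; exact (par_assoc _ _ _).trans (cast_id _ _ _)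
    have e3 : mk (xLeafL 0 p) ⊠ (mk (xLeafL 0 q) ⊠ mk (wires 2)) = (mk (xLeafL 0 p) ⊠ mk (xLeafL 0 q)) ⊠ mk (wires 2) := (par_assoc' _ _ _).trans (cast_id _ _ _)
    rw [e1, e2, e3]
  have hS : ((mk (wires 1) ⊠ mk swap) ⊠ mk (wires 1)) ⨟ ((mk (xLeafL 0 p) ⊠ mk (wires 1)) ⊠ (mk (xLeafL 0 q) ⊠ mk (wires 1))) = ((mk (xLeafL 0 p) ⊠ mk (xLeafL 0 q)) ⊠ mk (wires 2)) ⨟ ((mk (wires 1) ⊠ mk swap) ⊠ mk (wires 1)) := by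
    rw [g1, ← seq_par_wires, interchange, id_seq, swap_seq_par_one_one,
      show mk (xLeafL 0 p) ⊠ ((mk (xLeafL 0 q) ⊠ mk (wires 1)) ⨟ mk swap) = (mk (xLeafL 0 p) ⊠ (mk (xLeafL 0 q) ⊠ mk (wires 1))) ⨟ (mk (wires 1) ⊠ mk swap) from by rw [← seq_id (mk (xLeafL 0 p)), ← interchange, seq_id],
      seq_par_wires, g2]
  -- the wiring: the plugged and bent (B2) square is the leafy four-cycle
  have hW : (mk (wires 1) ⊠ mk cup) ⨟ ((((mk (Z 1 2 0) ⊠ mk (Z 1 2 0)) ⨟ ((mk (wires 1) ⊠ mk swap) ⊠ mk (wires 1)) ⨟ (mk (X 2 1 0) ⊠ mk (X 2 1 0))) ⨟ (mk (Z 1 0 p) ⊠ mk (Z 1 0 q))) ⊠ mk (wires 1)) =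
      mk (Z 1 2 0) ⨟ (mk (xLeafL 0 p) ⊠ mk (xLeafL 0 q)) ⨟ mk (Z 2 1 0) := by
    rw [seq_assoc (mk (Z 1 2 0) ⊠ mk (Z 1 2 0)), seq_assoc (mk (Z 1 2 0) ⊠ mk (Z 1 2 0)), seq_assoc ((mk (wires 1) ⊠ mk swap) ⊠ mk (wires 1)) (mk (X 2 1 0) ⊠ mk (X 2 1 0)),
      interchange (mk (X 2 1 0)) (mk (Z 1 0 p)) (mk (X 2 1 0)) (mk (Z 1 0 q)), ← xLeafL_par_wire_seq_cap, ← xLeafL_par_wire_seq_cap,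
      ← interchange (mk (xLeafL 0 p) ⊠ mk (wires 1)) (mk cap) (mk (xLeafL 0 q) ⊠ mk (wires 1)) (mk cap), ← seq_assoc ((mk (wires 1) ⊠ mk swap) ⊠ mk (wires 1)) ((mk (xLeafL 0 p) ⊠ mk (wires 1)) ⊠ (mk (xLeafL 0 q) ⊠ mk (wires 1))) (mk cap ⊠ mk cap), hS,
      ← seq_assoc (mk (Z 1 2 0) ⊠ mk (Z 1 2 0)), ← seq_assoc (mk (Z 1 2 0) ⊠ mk (Z 1 2 0)),
      show (mk (Z 1 2 0) ⊠ mk (Z 1 2 0)) ⨟ ((mk (xLeafL 0 p) ⊠ mk (xLeafL 0 q)) ⊠ mk (wires 2)) = (mk (Z 1 2 0) ⨟ (mk (xLeafL 0 p) ⊠ mk (xLeafL 0 q))) ⊠ mk (Z 1 2 0) from by rw [interchange, seq_id],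
      seq_assoc ((mk (Z 1 2 0) ⨟ (mk (xLeafL 0 p) ⊠ mk (xLeafL 0 q))) ⊠ mk (Z 1 2 0)), seq_par_wires,
      show ((mk (Z 1 2 0) ⨟ (mk (xLeafL 0 p) ⊠ mk (xLeafL 0 q))) ⊠ mk (Z 1 2 0)) ⊠ mk (wires 1) = (mk (Z 1 2 0) ⨟ (mk (xLeafL 0 p) ⊠ mk (xLeafL 0 q))) ⊠ (mk (Z 1 2 0) ⊠ mk (wires 1)) from
        (par_assoc _ _ _).trans (cast_id _ _ _),
      ← seq_assoc (mk (wires 1) ⊠ mk cup), interchange, id_seq, ← Z_zero_three_eq_cup_split_par,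
      par_eq_seq_left (mk (Z 1 2 0) ⨟ (mk (xLeafL 0 p) ⊠ mk (xLeafL 0 q))) (mk (Z 0 3 0)), par_empty, seq_par_wires, seq_assoc,
      show mk (wires (1 + 1)) = mk (wires 2) from rfl, ← seq_assoc (mk (wires 2) ⊠ mk (Z 0 3 0)), wires_par_Z_zero_three_yank]
  rw [← hW, ← one_two_seq_scalar_par_two', ← scalar_par_two_zero_par_one, ← scalar_par_two_two_seq_zero, rule_B2, seq_assoc, Z_seq_Z_par_effects,
    seq_par_wires, ← seq_assoc, par_cup_seq_xmerge_par]
  simp only [xLeafL, mk_seq, mk_par]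
  where
  one_two_seq_scalar_par_two' (A : ZXClass 1 3) (s : ZXClass 0 0) (B : ZXClass 3 1) : A ⨟ (s ⊠ B) = s ⊠ (A ⨟ B) := by
    rw [scalar_par_seq_right, empty_par, cast_id]
  scalar_par_two_zero_par_one (s : ZXClass 0 0) (A : ZXClass 2 0) : (s ⊠ A) ⊠ mk (wires 1) = s ⊠ (A ⊠ mk (wires 1)) := (par_assoc _ _ _).trans (cast_id _ _ _)
  scalar_par_two_two_seq_zero (s : ZXClass 0 0) (A : ZXClass 2 2) (B : ZXClass 2 0) : (s ⊠ A) ⨟ B = s ⊠ (A ⨟ B) := by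
    rw [scalar_par_seq_left, empty_par, cast_id]
  Z_seq_Z_par_effects : mk (Z 1 2 0) ⨟ (mk (Z 1 0 p) ⊠ mk (Z 1 0 q)) = mk (Z 1 0 (p + q)) := by
    rw [par_eq_seq_left (mk (Z 1 0 p)) (mk (Z 1 0 q)), ← seq_assoc, Z_seq_Z_par 1 1 1 0 le_rfl, add_zero p, empty_par, cast_id, Z_seq_Z 1 1 0 le_rfl]

end ZXClass

end Literature.Computability.QuantumComplexity
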